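import Literature.NumberTheory.GaloisCohomology.Howard2004.SelmerTriples
import Literature.NumberTheory.EllipticCurves.IwasawaAlgebraEisensteinQuotientDVRProofs
import Literature.NumberTheory.EllipticCurves.ZpExtensionScalarTwistResidualQuotient
import Literature.NumberTheory.EllipticCurves.ZpExtensionEisensteinTwistDualPerfect
import Literature.AlgebraicGeometry.Resolution.FormalFibres
import Literature.NumberTheory.GaloisRepresentations.PotentialDiagonalizabilityCriteriaProofs
import HarnessLib

/-!
# The coefficient-ring standing of Howard 2004 at the Eisenstein specialisation: `Λ`, `S_m = Λ/(T^m + p)`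
# and `A_{m,k} = Λ/(T^m + p, p^k)` are coefficient rings; `A_{m,k}` is principal Artinian of length `mk`
# (proved theorems; no named fact, no instance, no notation)

Topic `NumberTheory/EllipticCurves` (companion of `IwasawaAlgebraEisensteinQuotientDVRProofs` — `S_m` is a
complete discrete valuation ring with uniformiser `π = T mod q_m` and residue field `𝔽_p` — and of
`IwasawaAlgebraEisensteinFiniteQuotientProofs` / `ZpExtensionScalarTwist` §3 — the finite rings
`A_{m,k} = IwasawaAlgebra.EisensteinCoeff p m k`, non-trivial for `m, k ≥ 1` by `nontrivial_eisensteinCoeff` of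
`ZpExtensionEisensteinTwistFreeProofs`).

B. Howard, *The Heegner point Kolyvagin system*, Compositio Math. 140 (2004): «By a coefficient ring, `R`,
we mean a complete, Noetherian, local ring with finite residue field of characteristic `p`. The cases of
interest are when `R` is the ring of integers `𝒪` of a finite extension of `ℚ_p`, a quotient of `𝒪`, or the
Iwasawa algebra `Λ`» (§1, arXiv:1202.6340 p. 4 L47–52); «Of special interest is the case where `R` is
principal and Artinian of length `k` … `𝔪 = πR`» (Rem. 1.1.4); §1.6 «`R` is a discrete valuation ring»
(Thm. 1.6.1); proof of Thm. 2.2.10 «taking `𝔮 = T^m + p`».  The cell `pub/bsd-print-x9` types §1.1–1.3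
over the `Prop`s `Howard2004.IsCoefficientRing p R` and `Howard2004.IsPrincipalArtinianOfLength R k`
(`Literature/NumberTheory/GaloisCohomology/Howard2004/SelmerTriples`, §A); this file DISCHARGES them for the
three rings of the Eisenstein specialisation of the shared μ-item (rows 9/10):

* `IwasawaAlgebra.isAdicComplete_maximalIdeal` — `Λ = ℤ_p⟦T⟧` is `𝔪`-adically complete (tree
  `powerSeries_isAdicComplete_maximalIdeal` over Mathlib's complete `ℤ_p`); `IwasawaAlgebra.isCoefficientRing`
  — **`Λ` is a coefficient ring** (residue field `𝔽_p`: `natCast_residue_surjective`);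
* **`IwasawaAlgebra.isCoefficientRing_quotient_X_pow_add_C`** — `S_m = Λ/(q_m)` (`m ≥ 1`) is a coefficient
  ring; with the tree's `isDiscreteValuationRing_quotient_X_pow_add_C` this is EXACTLY the standing «`R` a
  discrete valuation ring [which is a coefficient ring]» of Thm. 1.6.1 at `R = S_m`;
* (with `isLocalRing_eisensteinCoeff` / `maximalIdeal_eisensteinCoeff_eq` = `(π)` of `ZpExtensionScalarTwistResidualQuotient`)
  `IwasawaAlgebra.EisensteinCoeff.ofSpec_eq_zero_iff` (kernel of `S_m ↠ A_{m,k}` is `p^k S_m`),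
  `….mk_X_pow_mul_eq_zero` / `….mk_X_pow_ne_zero` (`π^{mk} = 0 ≠ π^{mk−1}`),
  **`IwasawaAlgebra.EisensteinCoeff.isPrincipalArtinianOfLength : IsPrincipalArtinianOfLength A_{m,k} (m·k)`**
  and `IwasawaAlgebra.EisensteinCoeff.isCoefficientRing` (`m, k ≥ 1`).

Everything is [folklore] commutative algebra about `ℤ_p⟦T⟧/(T^m + p, p^k)` (Washington, *Cyclotomic
Fields* §7.1, §13.2); the statements are Howard's standing hypotheses instantiated, cited as such. Nothing
here concerns Selmer groups; BSD is not proved by any of this.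

References: [Howard2004HeegnerKolyvagin] §1 (p. 4 L47–52), Rem. 1.1.4, §1.6, proof of Thm. 2.2.10;
[Washington1997] §7.1, §13.2 (Lemma 13.7, Prop. 13.8); [Matsumura1987] Thm. 8.1/§8 (quotients of
complete local rings are complete).
-/

noncomputable section

open IsLocalRing

namespace Literature.NumberTheory.EllipticCurves.IwasawaAlgebra

open Literature.NumberTheory.GaloisCohomology.Howard2004

variable (p : ℕ) [hp : Fact p.Prime]

/-! ## §1 `Λ = ℤ_p⟦T⟧` is a coefficient ring -/

/-- **`Λ = ℤ_p⟦T⟧` is `𝔪_Λ`-adically complete** (`𝔪_Λ = (p, T)`): power series over the complete local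
ring `ℤ_p` (tree `powerSeries_isAdicComplete_maximalIdeal`, Mathlib's `IsAdicComplete (𝔪 ℤ_p) ℤ_p`).  The
Summits-side `Summit.BirchSwinnertonDyer.BirchSwinnertonDyer.Theorems.IwasawaTwoVariable.isAdicComplete_maximalIdeal_iwasawaAlgebra`
states the same (not importable under `Literature/`; this is its Literature home).
[cite: Howard2004HeegnerKolyvagin, §1 conventions (arXiv:1202.6340 p. 4, L47–52: Λ is a coefficient ring)] [cite: Washington1997, §7.1] -/
theorem isAdicComplete_maximalIdeal :
    IsAdicComplete (maximalIdeal (IwasawaAlgebra p)) (IwasawaAlgebra p) :=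
  Literature.NumberTheory.GaloisRepresentations.powerSeries_isAdicComplete_maximalIdeal (R := ℤ_[p])

/-- Every element of `Λ` is congruent modulo `𝔪_Λ = (p, T)` to a natural number (its constant term modulo
`p`): the cast `ℕ → Λ/𝔪_Λ` is surjective, so `Λ/𝔪_Λ = 𝔽_p`. [cite: Washington1997, §7.1 (Λ/(p,T) = ℤ/pℤ)] -/
theorem natCast_residue_surjective :
    ∀ x : ResidueField (IwasawaAlgebra p), ∃ n : ℕ, (n : ResidueField (IwasawaAlgebra p)) = x := by
  intro x
  obtain ⟨f, rfl⟩ := IsLocalRing.residue_surjective x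
  refine ⟨(PadicInt.toZMod (PowerSeries.constantCoeff f)).val, ?_⟩
  rw [← map_natCast (IsLocalRing.residue (IwasawaAlgebra p)), ← sub_eq_zero, ← map_sub,
    IsLocalRing.residue_eq_zero_iff]
  -- `n - f = (C (n - f₀)) - (f - C f₀)` with `p ∣ n - f₀` in `ℤ_p` and `T ∣ f - C f₀`
  set f₀ : ℤ_[p] := PowerSeries.constantCoeff f with hf₀
  have hp' : ((PadicInt.toZMod f₀).val : ℤ_[p]) - f₀ ∈ maximalIdeal ℤ_[p] := by
    rw [← PadicInt.ker_toZMod, RingHom.mem_ker, map_sub, map_natCast, ZMod.natCast_zmod_val, sub_self]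
  have hsplit : ((PadicInt.toZMod f₀).val : IwasawaAlgebra p) - f =
      PowerSeries.C (((PadicInt.toZMod f₀).val : ℤ_[p]) - f₀) - (f - PowerSeries.C f₀) := by
    rw [map_sub, map_natCast]; ring
  rw [hsplit]
  refine Ideal.sub_mem _ ?_ ?_
  · -- `C` of an element of `𝔪_{ℤ_p}` lies in `𝔪_Λ`
    rw [IsLocalRing.mem_maximalIdeal, mem_nonunits_iff]
    intro hu
    have hu0 := hu.map (PowerSeries.constantCoeff (R := ℤ_[p]))
    rw [PowerSeries.constantCoeff_C] at hu0
    exact (IsLocalRing.mem_maximalIdeal _ |>.mp hp') hu0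
  · have hX : (PowerSeries.X : IwasawaAlgebra p) ∣ f - PowerSeries.C f₀ := by
      rw [PowerSeries.X_dvd_iff, map_sub, PowerSeries.constantCoeff_C, hf₀, sub_self]
    obtain ⟨g, hg⟩ := hX
    rw [hg]
    refine Ideal.mul_mem_right _ _ ?_
    rw [IsLocalRing.mem_maximalIdeal, mem_nonunits_iff, PowerSeries.isUnit_iff_constantCoeff]
    simp

/-- **`Λ = ℤ_p⟦T⟧` is a coefficient ring in Howard's sense** (complete Noetherian local, residue field `𝔽_p`).
[cite: Howard2004HeegnerKolyvagin, §1 conventions (arXiv:1202.6340 p. 4, L47–52: «… or the Iwasawa algebra Λ»)] [cite: Washington1997, §7.1] -/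
theorem isCoefficientRing : IsCoefficientRing p (IwasawaAlgebra p) where
  isNoetherianRing := inferInstance
  isAdicComplete := isAdicComplete_maximalIdeal p
  finite_residueField := by
    haveI : Finite (Set.range (fun n : Fin p => ((n : ℕ) : ResidueField (IwasawaAlgebra p)))) :=
      Set.finite_range _ |>.to_subtype
    refine Finite.of_surjective (fun n : Fin p => ((n : ℕ) : ResidueField (IwasawaAlgebra p))) fun x => ?_
    obtain ⟨n, rfl⟩ := natCast_residue_surjective p x
    have hpz : (p : ResidueField (IwasawaAlgebra p)) = 0 := by
      rw [← map_natCast (IsLocalRing.residue (IwasawaAlgebra p)), IsLocalRing.residue_eq_zero_iff,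
        ← map_natCast (PowerSeries.C (R := ℤ_[p]))]
      exact C_p_mem_maximalIdeal p
    refine ⟨⟨n % p, Nat.mod_lt n hp.out.pos⟩, ?_⟩
    change ((n % p : ℕ) : ResidueField (IwasawaAlgebra p)) = n
    conv_rhs => rw [← Nat.mod_add_div n p]
    rw [Nat.cast_add, Nat.cast_mul, hpz, zero_mul, add_zero]
  charP_residueField := by
    refine (CharP.charP_iff_prime_eq_zero hp.out).mpr ?_
    rw [← map_natCast (IsLocalRing.residue (IwasawaAlgebra p)), IsLocalRing.residue_eq_zero_iff,
      ← map_natCast (PowerSeries.C (R := ℤ_[p]))]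
    exact C_p_mem_maximalIdeal p

/-! ## §2 `S_m = Λ/(T^m + p)` is a (discrete valuation) coefficient ring -/

/-- In `S_m = Λ/(q_m)`, `p = -π^m` (`q_m = T^m + p ↦ 0`, `π = T mod q_m`).
[cite: Howard2004HeegnerKolyvagin, proof of Thm. 2.2.10 (𝔮 = T^m + p)] [cite: Washington1997, §13.2] -/
theorem natCast_eq_neg_mk_X_pow_quotient_X_pow_add_C (m : ℕ) :
    ((p : IwasawaAlgebra p ⧸
        Ideal.span {(PowerSeries.X ^ m + PowerSeries.C (p : ℤ_[p]) : IwasawaAlgebra p)})) =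
      -((Ideal.Quotient.mk
          (Ideal.span {(PowerSeries.X ^ m + PowerSeries.C (p : ℤ_[p]) : IwasawaAlgebra p)})) PowerSeries.X) ^ m := by
  have hC : (PowerSeries.C (p : ℤ_[p]) : IwasawaAlgebra p) = (p : IwasawaAlgebra p) := map_natCast _ p
  have h : (Ideal.Quotient.mk
      (Ideal.span {(PowerSeries.X ^ m + PowerSeries.C (p : ℤ_[p]) : IwasawaAlgebra p)}))
      ((p : IwasawaAlgebra p) + PowerSeries.X ^ m) = 0 := by
    rw [Ideal.Quotient.eq_zero_iff_mem, ← hC, add_comm]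
    exact Ideal.mem_span_singleton_self _
  have h2 : ((p : IwasawaAlgebra p ⧸
      Ideal.span {(PowerSeries.X ^ m + PowerSeries.C (p : ℤ_[p]) : IwasawaAlgebra p)})) +
      ((Ideal.Quotient.mk
        (Ideal.span {(PowerSeries.X ^ m + PowerSeries.C (p : ℤ_[p]) : IwasawaAlgebra p)})) PowerSeries.X) ^ m =
      0 := by
    rw [← map_natCast (Ideal.Quotient.mk
        (Ideal.span {(PowerSeries.X ^ m + PowerSeries.C (p : ℤ_[p]) : IwasawaAlgebra p)})) p,
      ← map_pow (Ideal.Quotient.mk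
        (Ideal.span {(PowerSeries.X ^ m + PowerSeries.C (p : ℤ_[p]) : IwasawaAlgebra p)})) PowerSeries.X m,
      ← map_add]
    exact h
  exact eq_neg_of_add_eq_zero_left h2

/-- `p ∈ 𝔪_{S_m}` (`p = -π^m`, `m ≥ 1`), so the residue field of `S_m` has characteristic `p`.
[cite: Howard2004HeegnerKolyvagin, §2.2 (S_𝔮)] [cite: Washington1997, §13.2] -/
theorem natCast_mem_maximalIdeal_quotient_X_pow_add_C {m : ℕ} (hm : 1 ≤ m) :
    ((p : IwasawaAlgebra p ⧸
        Ideal.span {(PowerSeries.X ^ m + PowerSeries.C (p : ℤ_[p]) : IwasawaAlgebra p)})) ∈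
      @maximalIdeal _ _ (isLocalRing_quotient_X_pow_add_C p hm) := by
  letI := isLocalRing_quotient_X_pow_add_C p hm
  rw [maximalIdeal_quotient_X_pow_add_C_eq p hm, natCast_eq_neg_mk_X_pow_quotient_X_pow_add_C p m,
    Ideal.neg_mem_iff]
  exact Ideal.pow_mem_of_mem _ (Ideal.mem_span_singleton_self _) m hm

/-- **`S_m = Λ/(T^m + p)` is a coefficient ring in Howard's sense** (`m ≥ 1`): Noetherian (quotient of `Λ`),
local (tree), `𝔪`-adically complete (quotient of the complete Noetherian local `Λ`, tree
`Resolution.isAdicComplete_quotient`), residue field finite of order `p` (tree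
`natCard_residueField_quotient_X_pow_add_C`) and of characteristic `p`.  Together with the tree's
`isDiscreteValuationRing_quotient_X_pow_add_C`: `S_m` meets the standing hypothesis «`R` is a discrete
valuation ring» (and a coefficient ring) of Thm. 1.6.1.
[cite: Howard2004HeegnerKolyvagin, §1 conventions (arXiv p. 4, L47–52) and §1.6 Thm. 1.6.1 standing (arXiv p. 11, L13–18); proof of Thm. 2.2.10 (𝔮 = T^m + p)] [cite: Washington1997, §13.2 (Lemma 13.7, Prop. 13.8)] -/
theorem isCoefficientRing_quotient_X_pow_add_C {m : ℕ} (hm : 1 ≤ m) :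
    @IsCoefficientRing p (IwasawaAlgebra p ⧸
        Ideal.span {(PowerSeries.X ^ m + PowerSeries.C (p : ℤ_[p]) : IwasawaAlgebra p)}) _
      (isLocalRing_quotient_X_pow_add_C p hm) := by
  letI := isLocalRing_quotient_X_pow_add_C p hm
  haveI := isAdicComplete_maximalIdeal p
  haveI hfin : Finite (ResidueField (IwasawaAlgebra p ⧸
      Ideal.span {(PowerSeries.X ^ m + PowerSeries.C (p : ℤ_[p]) : IwasawaAlgebra p)})) :=
    Nat.finite_of_card_ne_zero (by
      rw [natCard_residueField_quotient_X_pow_add_C p hm]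
      exact hp.out.ne_zero)
  exact
    { isNoetherianRing := inferInstance
      isAdicComplete := Literature.AlgebraicGeometry.Resolution.isAdicComplete_quotient _
      finite_residueField := hfin
      charP_residueField := by
        refine (CharP.charP_iff_prime_eq_zero hp.out).mpr ?_
        rw [← map_natCast (IsLocalRing.residue (IwasawaAlgebra p ⧸
          Ideal.span {(PowerSeries.X ^ m + PowerSeries.C (p : ℤ_[p]) : IwasawaAlgebra p)})),
          IsLocalRing.residue_eq_zero_iff]
        exact natCast_mem_maximalIdeal_quotient_X_pow_add_C p hm }

/-! ## §3 `A_{m,k} = Λ/(T^m + p, p^k)` is local, principal Artinian of length `mk`, and a coefficient ring -/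

namespace EisensteinCoeff

variable {p}

/-- The reduction `S_m = Λ/(q_m) ↠ A_{m,k} = Λ/(q_m, p^k)` (tree `EisensteinCoeff.ofSpec`, Mathlib
`Ideal.Quotient.factor`) is surjective. [cite: Howard2004HeegnerKolyvagin, §2.2 (A_{m,k} = S_𝔮/p^k S_𝔮)] -/
theorem ofSpec_surjective (m k : ℕ) : Function.Surjective (ofSpec p m k) :=
  Ideal.Quotient.factor_surjective _

/-- The kernel of `S_m ↠ A_{m,k}` consists of multiples of `p^k`: `[f] ↦ 0` iff `[f]_{S_m} ∈ p^k S_m`.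
[cite: Howard2004HeegnerKolyvagin, §2.2 (A_{m,k} = S_𝔮/p^k S_𝔮)] -/
theorem ofSpec_eq_zero_iff (m k : ℕ)
    (s : IwasawaAlgebra p ⧸ Ideal.span {(PowerSeries.X ^ m + PowerSeries.C (p : ℤ_[p]) : IwasawaAlgebra p)}) :
    ofSpec p m k s = 0 ↔ ∃ c, s = c * (p : _) ^ k := by
  obtain ⟨f, rfl⟩ := Ideal.Quotient.mk_surjective s
  rw [ofSpec_mk, Ideal.Quotient.eq_zero_iff_mem, Submodule.mem_sup]
  constructor
  · rintro ⟨a, ha, b, hb, hab⟩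
    obtain ⟨c, rfl⟩ := Ideal.mem_span_singleton'.mp hb
    refine ⟨Ideal.Quotient.mk _ c, ?_⟩
    rw [← map_natCast (Ideal.Quotient.mk _), ← map_pow, ← map_mul, Ideal.Quotient.eq, ← hab,
      ← map_natCast (PowerSeries.C (R := ℤ_[p])), ← map_pow]
    simpa using ha
  · rintro ⟨c, hc⟩
    obtain ⟨g, rfl⟩ := Ideal.Quotient.mk_surjective c
    rw [← map_natCast (Ideal.Quotient.mk _), ← map_pow, ← map_mul, Ideal.Quotient.eq] at hc
    refine ⟨f - g * (p : IwasawaAlgebra p) ^ k, hc, g * (p : IwasawaAlgebra p) ^ k, ?_, by ring⟩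
    rw [← map_natCast (PowerSeries.C (R := ℤ_[p])), ← map_pow]
    exact Ideal.mul_mem_left _ _ (Ideal.mem_span_singleton_self _)

/-- `π^{mk} = 0` in `A_{m,k}` (`π^{mk} = (-p)^k`). [cite: Howard2004HeegnerKolyvagin, Rem. 1.1.4 («𝔪^k = 0»)] [cite: Washington1997, §13.2] -/
theorem mk_X_pow_mul_eq_zero (m k : ℕ) :
    ((Ideal.Quotient.mk _ PowerSeries.X : EisensteinCoeff p m k)) ^ (m * k) = 0 := by
  rw [← map_pow, Ideal.Quotient.eq_zero_iff_mem]
  exact X_pow_mul_mem_span_qm_sup_span_C_pow p m k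

/-- **`π^{mk-1} ≠ 0` in `A_{m,k}`** (`m, k ≥ 1`): otherwise `π^{mk-1} ∈ p^k S_m = π^{mk} S_m` in the domain
`S_m`, forcing `π^{mk-1}(1 - cπ) = 0` with `1 - cπ` a unit, i.e. `π = 0` — but `q_m ∤ T`.
[cite: Howard2004HeegnerKolyvagin, Rem. 1.1.4 («R … Artinian of length k»)] [cite: Washington1997, §13.2] -/
theorem mk_X_pow_ne_zero {m k : ℕ} (hm : 1 ≤ m) (hk : 1 ≤ k) :
    ((Ideal.Quotient.mk _ PowerSeries.X : EisensteinCoeff p m k)) ^ (m * k - 1) ≠ 0 := by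
  letI := isLocalRing_quotient_X_pow_add_C p hm
  haveI := isDomain_quotient_X_pow_add_C p hm
  intro h
  -- `π = T mod q_m` in the domain `S_m`
  let π : IwasawaAlgebra p ⧸
      Ideal.span {(PowerSeries.X ^ m + PowerSeries.C (p : ℤ_[p]) : IwasawaAlgebra p)} :=
    Ideal.Quotient.mk _ PowerSeries.X
  have h' : ofSpec p m k (π ^ (m * k - 1)) = 0 := by
    rw [map_pow]
    exact h
  obtain ⟨c, hc⟩ := (ofSpec_eq_zero_iff m k _).mp h'
  have h1 : 1 ≤ m * k := Nat.one_le_iff_ne_zero.mpr (Nat.mul_ne_zero (by omega) (by omega))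
  have hsplit : π ^ (m * k) = π ^ (m * k - 1) * π := by
    rw [← pow_succ, Nat.sub_add_cancel h1]
  have hp' : ((p : IwasawaAlgebra p ⧸
      Ideal.span {(PowerSeries.X ^ m + PowerSeries.C (p : ℤ_[p]) : IwasawaAlgebra p)})) ^ k =
      (-1) ^ k * (π ^ (m * k - 1) * π) := by
    rw [natCast_eq_neg_mk_X_pow_quotient_X_pow_add_C p m, ← hsplit, pow_mul]
    ring
  -- `π^(mk-1) · (1 - (-1)^k c π) = 0` in the domain `S_m`
  have key : π ^ (m * k - 1) * (1 - (-1) ^ k * c * π) = 0 := by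
    rw [mul_sub, mul_one, sub_eq_zero]
    conv_lhs => rw [hc, hp']
    ring
  rcases mul_eq_zero.mp key with h0 | h0
  · by_cases hmk1 : m * k - 1 = 0
    · rw [hmk1, pow_zero] at h0
      exact one_ne_zero h0
    · exact mk_X_ne_zero p hm ((pow_eq_zero_iff hmk1).mp h0)
  · -- `1 - uπ` is a unit since `π ∈ 𝔪_{S_m}`
    have hu : IsUnit (1 - (-1) ^ k * c * π) := by
      refine IsLocalRing.isUnit_one_sub_self_of_mem_nonunits _ ?_
      rw [← IsLocalRing.mem_maximalIdeal, maximalIdeal_quotient_X_pow_add_C_eq p hm]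
      exact Ideal.mul_mem_left _ _ (Ideal.mem_span_singleton_self _)
    exact hu.ne_zero h0

/-- **`A_{m,k}` is a principal Artinian local ring of length `mk`** (`m, k ≥ 1`): `𝔪 = (π)`, `𝔪^{mk} = 0`,
`𝔪^{mk-1} ≠ 0` — Howard's «`R` principal and Artinian of length `k`» for the level-`k` coefficient ring of
the Eisenstein specialisation (length `mk` because `e(S_m/ℤ_p) = m`).
[cite: Howard2004HeegnerKolyvagin, Rem. 1.1.4 (arXiv Rem. 2.1.4, p. 5) and proof of Thm. 2.2.10 (𝔮 = T^m + p)] [cite: Washington1997, §13.2] -/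
theorem isPrincipalArtinianOfLength {m k : ℕ} (hm : 1 ≤ m) (hk : 1 ≤ k) :
    @IsPrincipalArtinianOfLength (EisensteinCoeff p m k) _ (isLocalRing_eisensteinCoeff p hm hk) (m * k) := by
  letI := isLocalRing_eisensteinCoeff p hm hk
  refine { principal := ?_, pow_eq_bot := ?_, pow_pred_ne_bot := fun _ => ?_ }
  · rw [maximalIdeal_eisensteinCoeff_eq p hm hk]
    exact ⟨_, rfl⟩
  · rw [maximalIdeal_eisensteinCoeff_eq p hm hk, Ideal.span_singleton_pow, mk_X_pow_mul_eq_zero, Ideal.span_singleton_zero]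
  · rw [maximalIdeal_eisensteinCoeff_eq p hm hk, Ideal.span_singleton_pow, Ne, Ideal.span_singleton_eq_bot]
    exact mk_X_pow_ne_zero hm hk

/-- **`A_{m,k}` is a coefficient ring in Howard's sense** (`m, k ≥ 1`; «a quotient of `𝒪`»-type case: a
finite local ring): Noetherian, complete (quotient of the complete Noetherian local `Λ`), finite residue field
of characteristic `p`. [cite: Howard2004HeegnerKolyvagin, §1 conventions (arXiv p. 4, L47–52) and Rem. 1.1.4] [cite: Washington1997, §13.2] -/
theorem isCoefficientRing {m k : ℕ} (hm : 1 ≤ m) (hk : 1 ≤ k) :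
    @IsCoefficientRing p (EisensteinCoeff p m k) _ (isLocalRing_eisensteinCoeff p hm hk) := by
  letI := isLocalRing_eisensteinCoeff p hm hk
  haveI := isAdicComplete_maximalIdeal p
  haveI := finite_quotient_span_qm_sup_span_C_pow p hm k
  exact
    { isNoetherianRing := inferInstance
      isAdicComplete := Literature.AlgebraicGeometry.Resolution.isAdicComplete_quotient _
      finite_residueField :=
        Finite.of_surjective (IsLocalRing.residue (EisensteinCoeff p m k)) IsLocalRing.residue_surjective
      charP_residueField := by
        refine (CharP.charP_iff_prime_eq_zero hp.out).mpr ?_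
        rw [← map_natCast (IsLocalRing.residue (EisensteinCoeff p m k)), IsLocalRing.residue_eq_zero_iff,
          maximalIdeal_eisensteinCoeff_eq p hm hk]
        exact natCast_mem_span_mk_X p hm k }

end EisensteinCoeff

end Literature.NumberTheory.EllipticCurves.IwasawaAlgebra

end
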